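/-
Copyright: lit-balaban Phase-2 proof seat p08 (gen 7).  Statement-level skeleton of a published paper; no proof claims beyond what
the kernel checks below.
-/
import Literature.MathematicalPhysics.QuantumFieldTheory.BalabanImbrieJaffe1984to88.BIJ88Decay216Torus
import Literature.MathematicalPhysics.QuantumFieldTheory.BalabanImbrieJaffe1984to88.BIJ88Ineq219SigmaTorus

/-!
# `BalabanImbrieJaffe1984to88.BIJ88Ineq219TorusProp12` — T. Bałaban, J. Imbrie, A. Jaffe, *Effective action and cluster properties of the
abelian Higgs model*, Commun. Math. Phys. **114** (1988) 257–315 [BalabanImbrieJaffe1988]: **(2.18)–(2.19)** p. 262 ON THE TORI WITH THE (2.16)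
INPUT DISCHARGED — for p30's `σ_k = sigmaTorus hd η^d η⁻¹ k` and its (2.14)-truncation `σ_{k,loc} = trunc pdist R σ_k`: (2.18) `Close` and (2.19)
`Ineq219 σ_{k,loc} (c711(d))` for every truncation radius `R ≥ R₁`, ONE `R₁` FOR ALL SCALES, given only [6I] Proposition 1.2 by its tree name
(`B5.Prop12Printed`) and (7.2.3) for the matrices of the `C^{(j)}` — gen 7's torus (2.16) `BIJ88Decay216Torus.decay216_torus_of_prop12`, [I]
Theorem 7.1.1 on the tori with its k-UNIFORM constant at the physical weight (p33's `BIJ85Thm711Torus.thm711_sigmaTorus`, `2c711(d)`), p02's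
hence-step `BIJ88Close218Proof.ineq219_of_close` and gen 6's plaquette row sums

statement-level skeleton of published theorems with citation tags; proofs where landed; nothing here is a claim about the Yang–Mills mass gap

PDF held: `paper:balaban1988-cmp114-bij-abelian-higgs-effective-action` (journal page = PDF page + 256), p. 262 [PDF 6].

CITATION HEADER (lean-in-tree rule).  Part of the lit-balaban TYPED SKELETON (HOME `run/shared/lean/pub/lit-balaban/`), Phase-2 proof seat
p08 (gen 7), unit `lit-balaban-p08`; WHAT IS REPRODUCED = SKELETON rows **C2.Eq2.18**, **C2.Eq2.19** (owner r18, referee ref-5), kind «model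
instance» for the torus σ_k with the displayed (2.16) input of gen 7's `BIJ88Ineq219SigmaTorus` now supplied by `BIJ88Decay216Torus`.
TAKING line HOME/STATUS.md (gen 7, eleventh target).

THE PRINTED TEXT (p. 262 [PDF 6], verbatim): *"It was also shown in [2] that σ_k is bounded from below. In view of (2.16) we have |σ_{k,loc}(p₁,p₂)
− σ_k(p₁,p₂)| ≦ e^{−cr(e_k)}e^{−c dist(p₁,p₂)}, (2.18) so that if f^{(k)}(p) vanishes for p ∉ Λ, σ_{k,loc} ≧ c > 0 (2.19) as well."*

WHAT IS PROVED (0 `sorry`, standard axioms; theorems only — proof lane; standing range `k ≤ m + K`, `2 ≤ d`):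
* §1 `ineq219_sigmaKernel_eta` — r18's `Ineq219` for the kernel of `sigmaTorus hd η^d c k` with the k-UNIFORM constant `2c711(d)` ([I] Thm. 7.1.1
  at the physical weight, p33's `thm711_sigmaTorus`; gen 7's `ineq219_sigmaKernel` had `2c711(d)·w` at a fixed weight `w`); `ineq219_mono`.
* §2 `close_trunc_of_decay3` — the (2.18) mechanism for a kernel decaying in the THREE-constant shape (threshold `R₀`, prefactor `c₀`, rate `δ′`):
  `Close dist (trunc dist R K) K (c₀e^{−(δ′/2)R}) (δ′/2)` for `R ≥ R₀` (p02's `close_trunc_of_decayFar` with the constants kept apart).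
* §3 **`close218_ineq219_torus_of_prop12`** — given `B5.Prop12Printed` (scales `levStd`) and (7.2.3)-shape constants `(M_C, δ_C)`: `∃ R₀ c₀ δ′ > 0`,
  for every `k ≤ m + K` at which the `C^{(j)}` matrices obey (7.2.3): (2.18) `Close pdist σ_{k,loc} σ_k (c₀e^{−(δ′/2)R}) (δ′/2)` for every `R ≥ R₀`;
  and **`ineq219_torus_of_prop12`** — `∃ R₁`, for every such `k` and every `R ≥ R₁`: **(2.19) `Ineq219 σ_{k,loc} (c711(d))`** (the «r(e_k) large»
  condition made quantitative: `c₀e^{−(δ′/2)R}·d²(2(1 + (δ′/2)⁻¹))^d ≤ c711(d)` for `R ≥ R₁`, via `e^{−y} ≤ 1/y`).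
HONEST SCOPE.  (i) (7.2.3) is a hypothesis on the matrices of p11's `CE` (typed row C1.Eq7.2.3, `BIJ88Decay216Torus.cBound_of_ineq723`); [6I] Prop.
1.2 enters by name.  (ii) `σ_{k,loc}` = the sharp truncation (2.14) at any radius `R ≥ R₁` (print: `R = r(e_{k−1})/(2L)`).  (iii) `U = 1` real
abelian fields; torus; no `def`, no new named fact; NOT summit progress.  Unit `lit-balaban-p08` (literature-prover-lit-balaban-p08-g7-0), 2026-08-21.
-/

open scoped BigOperators RealInnerProductSpace

namespace Literature.MathematicalPhysics.QuantumFieldTheory.BalabanImbrieJaffe1984to88.BIJ88Ineq219TorusProp12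

open Balaban1983to89 hiding Site Plaq
open Balaban1983to89.LatticeFieldCalculus
open BIJ88Sect2Statements (Ineq219 Close trunc applyK)
open BIJ88Close218Proof (ineq219_of_close)
open BIJ88Ineq217NearPart (pdist)
open BIJ88Ineq217SigmaTorus BIJ88Ineq219SigmaTorus BIJ88Decay216Torus
open BIJ85Prop521Torus BIJ85Sigma421Torus BIJ85Prop522Torus BIJ85Sigma422Eta BIJ85Thm711Torus BIJ85SigmaClosedCube
open BIJ85Ineq722Torus (torusRep levStd levStd_le supDist_triangle)
open BIJ85Ineq722ProofPart2 (settingOf)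
open BIJ85Ineq722DeltaA (deltaAData)
-- inside this namespace the bare `Site`/`Plaq` are the `ℤ^d` carriers of the QFT root; the torus ones are renamed:
open Balaban1983to89 renaming Site → TSite, Plaq → TPlaq

noncomputable section

variable {P : Params}

/-! ## §1  (2.19)'s input «σ_k is bounded from below [2]» with the k-uniform constant -/

/-- **«It was also shown in [2] that σ_k is bounded from below» FOR THE KERNEL OF THE TORUS σ_k AT THE PHYSICAL WEIGHT, k-UNIFORMLY**:
r18's `Ineq219 σ_k (2c711(d))` for the kernel `σ_k(p, q) = (σ_ke_q)(p)` of `sigmaTorus hd η^d c k` — [I] Thm. 7.1.1 on the tori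
(p33's `thm711_sigmaTorus`, constant `2c711(d)` independent of `k` and of the volume). [cite: BalabanImbrieJaffe1988, (2.19) p.262] -/
theorem ineq219_sigmaKernel_eta (hd : 2 ≤ P.d) {k : ℕ} (hk : k ≤ P.m + P.K) {c : ℝ} (hc : c ≠ 0) :
    Ineq219 (fun p q => sigmaTorus (P := P) hd ((P.eta k) ^ P.d) c k (toU P k (Pi.single q 1)) p) (2 * c711 P.d) := by
  refine ⟨by have := c711_pos (show 0 < P.d by have := P.hd; omega); positivity, fun f => ?_⟩
  rw [inner_eq_sum_applyK, sum_sq_eq_norm_toU_sq]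
  exact thm711_sigmaTorus hd hk hc (toU P k f)

/-- `Ineq219` is monotone in its constant. [cite: BalabanImbrieJaffe1988, (2.19) p.262] -/
theorem ineq219_mono {α : Type*} [Fintype α] {K : α → α → ℝ} {c c' : ℝ} (h : Ineq219 K c) (hc' : 0 < c') (hle : c' ≤ c) :
    Ineq219 K c' :=
  ⟨hc', fun f => (mul_le_mul_of_nonneg_right hle (Finset.sum_nonneg fun p _ => sq_nonneg (f p))).trans (h.2 f)⟩

/-! ## §2  The (2.18) mechanism for a three-constant decay -/

/-- **(2.18) for the sharp truncation of a kernel decaying beyond a threshold**: if `|K(a, b)| ≤ c₀e^{−δ′dist(a,b)}` whenever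
`dist(a, b) ≥ R₀` (`c₀, δ′ ≥ 0`), then for every `R ≥ R₀`, `|trunc_R K − K| ≤ (c₀e^{−(δ′/2)R})·e^{−(δ′/2)dist}` — inside `R` the difference
vanishes, outside `e^{−δ′D} ≤ e^{−(δ′/2)R}e^{−(δ′/2)D}` (p02's `close_trunc_of_decayFar` with prefactor, rate and threshold kept apart).
[cite: BalabanImbrieJaffe1988, (2.18) p.262] -/
theorem close_trunc_of_decay3 {α : Type*} {dist : α → α → ℝ} {K : α → α → ℝ} {R₀ c₀ δ' R : ℝ} (hc₀ : 0 ≤ c₀) (hδ' : 0 ≤ δ')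
    (hR : R₀ ≤ R) (hK : ∀ a b, R₀ ≤ dist a b → |K a b| ≤ c₀ * Real.exp (-δ' * dist a b)) :
    Close dist (trunc dist R K) K (c₀ * Real.exp (-(δ' / 2) * R)) (δ' / 2) := by
  intro a b
  by_cases hab : dist a b ≤ R
  · simp only [trunc, if_pos hab, sub_self, abs_zero]
    positivity
  · rw [not_le] at hab
    simp only [trunc, if_neg (not_le.2 hab), zero_sub, abs_neg]
    refine (hK a b (hR.trans hab.le)).trans ?_
    rw [mul_assoc, ← Real.exp_add]
    refine mul_le_mul_of_nonneg_left (Real.exp_le_exp.2 ?_) hc₀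
    nlinarith [hab, hδ']

/-! ## §3  (2.18)–(2.19) on the tori given only [6I] Proposition 1.2 and (7.2.3) -/

/-- **(2.18) ON THE TORI WITH (2.16) DISCHARGED**: from `B5.Prop12Printed` (scales `levStd`) and (7.2.3)-shape constants `(M_C, δ_C)`:
`∃ R₀, c₀ ≥ 0, δ′ > 0` such that for every `k ≤ m + K` at which the matrices of the `C^{(j)}`, `j < k`, obey (7.2.3), and every `R ≥ R₀`,
`Close pdist σ_{k,loc} σ_k (c₀e^{−(δ′/2)R}) (δ′/2)` for the kernel of `sigmaTorus hd η^d η⁻¹ k` and its (2.14)-truncation at radius `R`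
(`BIJ88Decay216Torus.decay216_torus_of_prop12` into `close_trunc_of_decay3`). [cite: BalabanImbrieJaffe1988, (2.18) p.262] -/
theorem close218_torus_of_prop12 (hd : 2 ≤ P.d) {a : ℝ} (ha : 0 < a)
    (h12 : B5.Prop12Printed (fun i => settingOf (torusRep P (levStd P i) (deltaAData (levStd_le i) a)) i))
    {δC MC : ℝ} (hδC : 0 < δC) (hMC : 0 ≤ MC) :
    ∃ R₀ c₀ δ' : ℝ, 0 < δ' ∧ 0 ≤ c₀ ∧ ∀ (k : ℕ) (hk : k ≤ P.m + P.K),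
      (∀ j < k, ∀ b b' : PBond P j, |⟪toEj P j (Pi.single b 1),
        CE P ((P.eta k) ^ P.d) ((P.L : ℝ) ^ k) j (toEj P j (Pi.single b' 1))⟫| ≤ MC * Real.exp (-(δC * (supDist b.src b'.src : ℝ)))) →
      ∀ R : ℝ, R₀ ≤ R →
        Close pdist (trunc pdist R fun p q => sigmaTorus (P := P) hd ((P.eta k) ^ P.d) ((P.L : ℝ) ^ k) k (toU P k (Pi.single q 1)) p)
          (fun p q => sigmaTorus (P := P) hd ((P.eta k) ^ P.d) ((P.L : ℝ) ^ k) k (toU P k (Pi.single q 1)) p)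
          (c₀ * Real.exp (-(δ' / 2) * R)) (δ' / 2) := by
  obtain ⟨R₀, c₀, δ', hδ', hc₀, h216⟩ := decay216_torus_of_prop12 hd ha h12 hδC hMC
  exact ⟨R₀, c₀, δ', hδ', hc₀, fun k hk hC R hR => close_trunc_of_decay3 hc₀ hδ'.le hR (h216 k hk hC)⟩

/-- `c₀Se^{−(δ′/2)R} ≤ γ` for `R ≥ max(1, 2c₀S/(δ′γ))`: the quantitative «r(e_k) large» (`e^{−y} ≤ 1/y` for `y > 0`). [folklore] -/
private theorem small_of_large {c₀ S δ' γ R : ℝ} (hc₀ : 0 ≤ c₀) (hS : 0 ≤ S) (hδ' : 0 < δ') (hγ : 0 < γ) (hR1 : 1 ≤ R)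
    (hR : 2 * (c₀ * S) / (δ' * γ) ≤ R) : c₀ * Real.exp (-(δ' / 2) * R) * S ≤ γ := by
  have hy : 0 < δ' / 2 * R := by positivity
  have hexp : Real.exp (-(δ' / 2) * R) ≤ 1 / (δ' / 2 * R) := by
    rw [neg_mul, Real.exp_neg, one_div]
    exact inv_anti₀ hy ((by linarith : δ' / 2 * R ≤ δ' / 2 * R + 1).trans (Real.add_one_le_exp _))
  have h1 : c₀ * Real.exp (-(δ' / 2) * R) * S ≤ c₀ * (1 / (δ' / 2 * R)) * S :=
    mul_le_mul_of_nonneg_right (mul_le_mul_of_nonneg_left hexp hc₀) hS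
  refine h1.trans ?_
  rw [div_le_iff₀ (by positivity)] at hR
  rw [mul_one_div, div_mul_eq_mul_div, div_le_iff₀ hy]
  nlinarith

/-- **(2.19) ON THE TORI WITH (2.16) DISCHARGED — «σ_{k,loc} ≧ c > 0» FOR `r(e_k)` LARGE, ONE RADIUS FOR ALL SCALES**: from `B5.Prop12Printed`
(scales `levStd`) and (7.2.3)-shape constants `(M_C, δ_C)`: `∃ R₁` such that for every `k ≤ m + K` at which the matrices of the `C^{(j)}`,
`j < k`, obey (7.2.3), and every truncation radius `R ≥ R₁`, r18's `Ineq219 σ_{k,loc} (c711(d))` holds for the (2.14)-truncation of the kernel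
of `sigmaTorus hd η^d η⁻¹ k` — the lower bound `2c711(d)` of [I] Thm. 7.1.1 (`ineq219_sigmaKernel_eta`), the closeness (2.18)
(`close218_torus_of_prop12`), p02's `ineq219_of_close` with gen 6's plaquette row sums, and `c₀e^{−(δ′/2)R}·d²(2(1 + (δ′/2)⁻¹))^d ≤ c711(d)`
for `R ≥ R₁`. [cite: BalabanImbrieJaffe1988, (2.19) p.262] -/
theorem ineq219_torus_of_prop12 (hd : 2 ≤ P.d) {a : ℝ} (ha : 0 < a)
    (h12 : B5.Prop12Printed (fun i => settingOf (torusRep P (levStd P i) (deltaAData (levStd_le i) a)) i))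
    {δC MC : ℝ} (hδC : 0 < δC) (hMC : 0 ≤ MC) :
    ∃ R₁ : ℝ, ∀ (k : ℕ) (hk : k ≤ P.m + P.K),
      (∀ j < k, ∀ b b' : PBond P j, |⟪toEj P j (Pi.single b 1),
        CE P ((P.eta k) ^ P.d) ((P.L : ℝ) ^ k) j (toEj P j (Pi.single b' 1))⟫| ≤ MC * Real.exp (-(δC * (supDist b.src b'.src : ℝ)))) →
      ∀ R : ℝ, R₁ ≤ R →
        Ineq219 (trunc pdist R fun p q => sigmaTorus (P := P) hd ((P.eta k) ^ P.d) ((P.L : ℝ) ^ k) k (toU P k (Pi.single q 1)) p)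
          (c711 P.d) := by
  obtain ⟨R₀, c₀, δ', hδ', hc₀, h218⟩ := close218_torus_of_prop12 hd ha h12 hδC hMC
  have hd0 : 0 < P.d := by have := P.hd; omega
  have hγ : 0 < c711 P.d := c711_pos hd0
  set S : ℝ := (P.d : ℝ) * P.d * (2 * (1 + (δ' / 2)⁻¹)) ^ P.d with hS
  have hS0 : 0 ≤ S := by positivity
  refine ⟨max R₀ (max 1 (2 * (c₀ * S) / (δ' * c711 P.d))), fun k hk hC R hR => ?_⟩
  have hR0 : R₀ ≤ R := (le_max_left _ _).trans hR
  have hR1 : 1 ≤ R := ((le_max_left _ _).trans (le_max_right _ _)).trans hR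
  have hR2 : 2 * (c₀ * S) / (δ' * c711 P.d) ≤ R := ((le_max_right _ _).trans (le_max_right _ _)).trans hR
  have hsmall' : c₀ * Real.exp (-(δ' / 2) * R) * S ≤ c711 P.d := small_of_large hc₀ hS0 hδ' hγ hR1 hR2
  have hL : ((P.L : ℝ) ^ k) ≠ 0 := pow_ne_zero _ P.cast_L_pos.ne'
  have h := ineq219_of_close (ineq219_sigmaKernel_eta hd hk hL) (h218 k hk hC R hR0) pdist_comm
    (fun p₁ => BIJ88Ineq217Torus.sum_plaq_exp_neg_pdist_le (half_pos hδ') p₁) (by positivity) (by linarith)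
  exact ineq219_mono h hγ (by linarith)

end

end Literature.MathematicalPhysics.QuantumFieldTheory.BalabanImbrieJaffe1984to88.BIJ88Ineq219TorusProp12
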